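import Mathlib.MeasureTheory.Group.Measure
import Mathlib.MeasureTheory.Integral.Bochner.Set
import Literature.MathematicalPhysics.QuantumFieldTheory.TorusChartSpinWaveIntegral
import HarnessLib

/-!
# Crux `BirComplexStableXYR`, line `fat-gaussian-defect-calculus`: stub U2 `stub_pinnedTiling`

Registered stub (lead c7, skeleton `Cruxes/BirComplexStableXYR/Lines/fat_gaussian_defect_calculus.lean`):
**pinned tiling.**  The pinned real field space `{φ : ι → ℝ | φ x₀ ∈ [0,2π)}` is the disjoint union, over the
integer fields `n` with `n x₀ = 0`, of the translates `[0,2π)^ι + 2πn` of the half-open cube; by countable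
additivity and translation invariance of Lebesgue measure on `ι → ℝ`, the integral of an integrable `f` over
the pinned space is the `HasSum`-sum of the cube integrals of the translates `f (· + 2πn)`
(the measure-theoretic core of the Fröhlich–Spencer unfolding of a torus integral).

Proof: the tiles `S n := {φ | φ - 2πn ∈ [0,2π)^ι}` are measurable, pairwise disjoint (coordinatewise
uniqueness of `toIcoDiv`) and cover the pinned space (`n x := toIcoDiv 2π 0 (φ x)`, and `n x₀ = 0` because
`φ x₀ ∈ [0,2π)`); then `MeasureTheory.hasSum_integral_iUnion`, and termwise
`MeasurePreserving.setIntegral_preimage_emb` for the translation `φ ↦ φ + 2πn`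
(`measurePreserving_add_right`), whose preimage of `S n` is the cube.  No definitions; sorry-free.
-/

set_option linter.dupNamespace false -- summit = problem name (single-conjunct summit), D-0017

namespace Summit.HubbardSuperconductivity.HubbardSuperconductivity.Theorems.FSUnfolding

open MeasureTheory Set

/-- Coordinatewise uniqueness of the tile index: if `ψ - 2πk ∈ [0,2π)` then `k = toIcoDiv 2π 0 ψ`.
[folklore] -/
theorem toIcoDiv_two_pi_eq_of_sub_mem_Ico {ψ : ℝ} {k : ℤ}
    (h : ψ - 2 * Real.pi * (k : ℝ) ∈ Set.Ico (0 : ℝ) (2 * Real.pi)) :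
    toIcoDiv Real.two_pi_pos 0 ψ = k := by
  refine toIcoDiv_eq_of_sub_zsmul_mem_Ico Real.two_pi_pos ?_
  rwa [zero_add, zsmul_eq_mul, mul_comm (k : ℝ)]

/-- The reduction modulo `2π`: `ψ - 2π · toIcoDiv 2π 0 ψ ∈ [0,2π)`. [folklore] -/
theorem sub_two_pi_mul_toIcoDiv_mem_Ico (ψ : ℝ) :
    ψ - 2 * Real.pi * (toIcoDiv Real.two_pi_pos 0 ψ : ℝ) ∈ Set.Ico (0 : ℝ) (2 * Real.pi) := by
  have h := sub_toIcoDiv_zsmul_mem_Ico Real.two_pi_pos 0 ψ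
  rwa [zero_add, zsmul_eq_mul, mul_comm ((toIcoDiv Real.two_pi_pos 0 ψ : ℤ) : ℝ)] at h

/-- **Pinned tiling** (binder form).  For `f` integrable on the pinned space `{φ | φ x₀ ∈ [0,2π)}`,
`HasSum (n ↦ ∫_{[0,2π)^ι} f (φ + 2πn) dφ) (∫_{φ x₀ ∈ [0,2π)} f)`, the sum running over the integer fields
`n` with `n x₀ = 0`. [folklore] -/
theorem hasSum_setIntegral_cube_translate {ι : Type*} [Fintype ι] (x₀ : ι) (f : (ι → ℝ) → ℂ)
    (hf : IntegrableOn f {φ : ι → ℝ | φ x₀ ∈ Set.Ico 0 (2 * Real.pi)}) :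
    HasSum (fun n : {n : ι → ℤ // n x₀ = 0} =>
        ∫ φ in Set.pi Set.univ (fun _ : ι => Set.Ico (0:ℝ) (2 * Real.pi)),
          f (fun x => φ x + 2 * Real.pi * ((n.1 x : ℤ) : ℝ)))
      (∫ φ in {φ : ι → ℝ | φ x₀ ∈ Set.Ico 0 (2 * Real.pi)}, f φ) := by
  -- the translation fields `v n = 2πn` and the tiles `S n = [0,2π)^ι + 2πn`
  obtain ⟨v, hv⟩ : ∃ v : {n : ι → ℤ // n x₀ = 0} → (ι → ℝ), v = fun n x => 2 * Real.pi * ((n.1 x : ℤ) : ℝ) :=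
    ⟨_, rfl⟩
  obtain ⟨C, hC⟩ : ∃ C : Set (ι → ℝ), C = Set.pi Set.univ (fun _ : ι => Set.Ico (0:ℝ) (2 * Real.pi)) :=
    ⟨_, rfl⟩
  obtain ⟨S, hS⟩ : ∃ S : {n : ι → ℤ // n x₀ = 0} → Set (ι → ℝ), S = fun n => (fun φ => φ - v n) ⁻¹' C :=
    ⟨_, rfl⟩
  have hCm : MeasurableSet C := hC ▸ MeasurableSet.univ_pi fun _ => measurableSet_Ico
  have hSm : ∀ n, MeasurableSet (S n) := fun n => hS ▸ (measurable_sub_const (v n)) hCm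
  have hmemS : ∀ n φ, φ ∈ S n ↔ ∀ x, φ x - 2 * Real.pi * ((n.1 x : ℤ) : ℝ) ∈ Set.Ico (0:ℝ) (2 * Real.pi) := by
    intro n φ
    simp only [hS, hC, hv, Set.mem_preimage, Set.mem_univ_pi, Pi.sub_apply]
  -- the tiles are pairwise disjoint
  have hSd : Pairwise (Function.onFun Disjoint S) := by
    intro n n' hne
    refine Set.disjoint_left.2 fun φ hφ hφ' => hne ?_
    apply Subtype.ext
    funext x
    rw [← toIcoDiv_two_pi_eq_of_sub_mem_Ico ((hmemS n φ).1 hφ x),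
      toIcoDiv_two_pi_eq_of_sub_mem_Ico ((hmemS n' φ).1 hφ' x)]
  -- the tiles cover the pinned space
  have hSU : (⋃ n, S n) = {φ : ι → ℝ | φ x₀ ∈ Set.Ico 0 (2 * Real.pi)} := by
    ext φ
    simp only [Set.mem_iUnion, Set.mem_setOf_eq]
    constructor
    · rintro ⟨n, hn⟩
      have h := (hmemS n φ).1 hn x₀
      rwa [n.2, Int.cast_zero, mul_zero, sub_zero] at h
    · intro hφ
      refine ⟨⟨fun x => toIcoDiv Real.two_pi_pos 0 (φ x), ?_⟩, ?_⟩
      · exact toIcoDiv_two_pi_eq_of_sub_mem_Ico (by rwa [Int.cast_zero, mul_zero, sub_zero])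
      · exact (hmemS _ φ).2 fun x => sub_two_pi_mul_toIcoDiv_mem_Ico (φ x)
  -- countable additivity over the tiles
  have hsum := hasSum_integral_iUnion (μ := volume) (f := f) hSm hSd (by rw [hSU]; exact hf)
  rw [hSU] at hsum
  refine hsum.congr_fun fun n => ?_
  -- termwise: translate the tile `S n` back to the cube
  have hmp : MeasurePreserving (fun φ : ι → ℝ => φ + v n) volume volume :=
    measurePreserving_add_right volume (v n)
  have hpre : (fun φ : ι → ℝ => φ + v n) ⁻¹' (S n) = C := by
    ext φ
    simp only [hS, Set.mem_preimage, add_sub_cancel_right]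
  have h := hmp.setIntegral_preimage_emb (measurableEmbedding_addRight (v n)) f (S n)
  rw [hpre, hC] at h
  rw [← h, hv]
  rfl

/-- **Stub U2 `stub_pinnedTiling` (registered signature, verbatim): pinned tiling.**  The pinned field space
`{φ : φ x₀ ∈ [0,2π)}` is the disjoint union of the translates `[0,2π)^ι + 2πn` over the integer fields `n`
with `n x₀ = 0`, so the integral of an integrable `f` over it is the sum of the cube integrals of its
translates (translation invariance of Lebesgue measure on `ι → ℝ`). [folklore] -/
theorem stub_pinnedTiling :
    ∀ (ι : Type) [Fintype ι] [DecidableEq ι] (x₀ : ι) (f : (ι → ℝ) → ℂ),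
      IntegrableOn f {φ : ι → ℝ | φ x₀ ∈ Set.Ico 0 (2 * Real.pi)} →
      HasSum (fun n : {n : ι → ℤ // n x₀ = 0} =>
          ∫ φ in Set.pi Set.univ (fun _ : ι => Set.Ico (0:ℝ) (2 * Real.pi)),
            f (fun x => φ x + 2 * Real.pi * ((n.1 x : ℤ) : ℝ)))
        (∫ φ in {φ : ι → ℝ | φ x₀ ∈ Set.Ico 0 (2 * Real.pi)}, f φ) :=
  fun _ _ _ x₀ f hf => hasSum_setIntegral_cube_translate x₀ f hf

end Summit.HubbardSuperconductivity.HubbardSuperconductivity.Theorems.FSUnfolding
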